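import Summits.QuantumFields.BalabanUV.T4Continuum.Support.NE7K1LinHomKernelBond

/-!
# NE7K1LinHomLift — row NE7 (node U5), candidate route HOM, path H1L, cell K1-lin(s): THE HOMOGENISED (tensor-product) LIFT of a
# coarse field to run B's lattice on a box — exact `L`-block means, and its fine increment as an ABEL SUM of coarse gradients

Lineage `b2b-balaban-t4-ne7-p2` (CRUX PROVER NE7 #2), generation 66 (fifth file of the L-UNIFORM upper two-run constant).  On the
coarse box `Π_μ [0, N_μ)` and the fine box `Π_μ [0, N_μ L)` the lift of `V` is `Φ(x) = Σ_Y V(Y)·Π_μ k̃_μ(x_μ, Y_μ)` with the folded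
one-dimensional kernels of `NE7K1LinHomKernel`.  All [folklore]:

* §1 one-dimensional wrappers: sums over `Ico 0 N ⊂ ℤ` as sums over `range N`; the row bounds `Σ_Y|k̃(t,Y)| ≤ 3∕2`,
  `L·Σ_Y|b(t,Y)| ≤ 3` at an ARBITRARY fine site ∕ bond `t` of the segment (block decomposition `t = L(t∕L) + t % L`).
* §2 `liftK`, `lift`, the bond kernel `bondK ν x Y = b_ν(x_ν,Y_ν)·Π_{μ≠ν} k̃_μ(x_μ,Y_μ)`; **EXACT BLOCK MEANS**
  `Σ_j Φ(LX + j) = L^{d+1}·V(X)` (`sum_lift_block`: the sum over offsets factorises, `Finset.prod_univ_sum`, and each factor is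
  `NE7K1LinHomKernel.sum_kerF_block`).
* §3 the kernel increment in direction `ν` is an Abel difference `K(x+e_ν,Y) − K(x,Y) = c_ν(x,Y) − c_ν(x,Y−e_ν)` (`liftK_succ_sub`),
  whence **`lift_succ_sub`**: `Φ(x+e_ν) − Φ(x) = Σ_{Y, Y+e_ν ∈ box} (V(Y) − V(Y+e_ν))·c_ν(x,Y)` — the top layer drops by
  `b(·, N−1) = 0`, the bottom layer by `b(·, −1) = 0`, the rest is re-indexed (`Finset.sum_nbij'`).  The coarse GRADIENT, not the
  coarse field, drives the fine increment: this is what makes the constant of `NE7K1LinHomUpper` independent of `L`.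

HONEST FRAMING: Gaussian `A = 0`, finite boxes, finite real matrices, [folklore] over the tree's `B4Lower18` ∕ `NE7K1Lin*`
certificates; ONE RG step in `U = 1` gauge; a census ∕ NEEDS-CONSTANT improvement of the cell K1-lin(s) (the upper two-run constant
`L` ↦ `C(d)` independent of `L`), no letter ∕ tag ∕ size of NE7 moves; nothing printed asserted; no `sorry`.  FIXED FINITE T⁴, rung
(B)+1; NE7 NOT PRINTED ∕ NOT PROVED; spine 0∕9; NOT infinite volume, NOT mass gap, NOT Clay.  HONEST DEPENDENCY: continuum YM on T⁴ ⇐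
BetaPertH ∧ nine spine estimates (0/9 proved); BetaPertH ⇐ (D1) ∧ (D4) ∧ CAP+tail; G-an2-4 gates asym, D1 and NE2/3/4.
-/

noncomputable section

open Finset Matrix

namespace Summit.QuantumFields.BalabanUV.T4Continuum.NE7K1LinHomLift

open Literature.MathematicalPhysics.QuantumFieldTheory.Balaban1983to89
open Literature.MathematicalPhysics.QuantumFieldTheory.Balaban1983to89.B4Reflection242
open Literature.MathematicalPhysics.QuantumFieldTheory.Balaban1983to89.B4BoxCov237
open Literature.MathematicalPhysics.QuantumFieldTheory.Balaban1983to89.B4Lower18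
open Literature.MathematicalPhysics.QuantumFieldTheory.Balaban1983to89.B4Green244 (finePt)
open NE7K1LinHomKernel NE7K1LinHomKernelSums NE7K1LinHomKernelBond

variable {d : ℕ}

/-! ### §1 One-dimensional wrappers: sums over `Ico 0 N ⊂ ℤ`, row bounds at an arbitrary fine site -/

section OneDim

variable {N L : ℕ}

/-- `Ico 0 N ⊂ ℤ` is the image of `range N`. [folklore] -/
theorem Ico_zero_eq_image (N : ℕ) : Finset.Ico (0 : ℤ) N = (range N).image (Nat.cast : ℕ → ℤ) := by
  ext y
  simp only [Finset.mem_Ico, Finset.mem_image, Finset.mem_range]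
  constructor
  · rintro ⟨h0, hN⟩
    exact ⟨y.toNat, by omega, by omega⟩
  · rintro ⟨m, hm, rfl⟩
    omega

/-- a sum over `Ico 0 N ⊂ ℤ` as a sum over `range N`. [folklore] -/
theorem sum_Ico_eq_sum_range (f : ℤ → ℝ) (N : ℕ) : ∑ y ∈ Finset.Ico (0 : ℤ) N, f y = ∑ y ∈ range N, f (y : ℤ) := by
  rw [Ico_zero_eq_image, ← sum_range_cast]

/-- block decomposition of a fine site of the segment: `t = L·(t∕L) + t % L`. [folklore] -/
theorem fine_decomp (hL : 1 ≤ L) {t : ℤ} (ht0 : 0 ≤ t) (ht : t < N * L) :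
    (0 ≤ t / (L : ℤ) ∧ t / (L : ℤ) < N) ∧ (0 ≤ t % (L : ℤ) ∧ t % (L : ℤ) < L) ∧ (L : ℤ) * (t / L) + t % L = t := by
  have hL0 : (0 : ℤ) < L := by exact_mod_cast hL
  refine ⟨⟨Int.ediv_nonneg ht0 hL0.le, (Int.ediv_lt_iff_lt_mul hL0).2 ht⟩,
    ⟨Int.emod_nonneg t hL0.ne', Int.emod_lt_of_pos t hL0⟩, Int.mul_ediv_add_emod t L⟩

/-- the kernel's row sum at an arbitrary fine site of the segment: `Σ_{Y<N}|k̃(t,Y)| ≤ 3∕2`. [folklore] -/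
theorem kerF_row_abs' (hL : 1 ≤ L) {t : ℤ} (ht0 : 0 ≤ t) (ht : t < N * L) :
    ∑ Y ∈ range N, |kerF N L t Y| ≤ 3 / 2 := by
  obtain ⟨⟨hX0, hXN⟩, ⟨hj0, hjL⟩, e⟩ := fine_decomp (N := N) hL ht0 ht
  rw [← e]
  exact kerF_row_abs hL hX0 hXN hj0 hjL

/-- the bond kernel's row sum at an arbitrary fine bond of the segment: `L·Σ_{Y<N}|b(t,Y)| ≤ 3`. [folklore] -/
theorem bondF_row_abs' (hL : 1 ≤ L) {t : ℤ} (ht0 : 0 ≤ t) (ht : t + 1 < N * L) :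
    (L : ℝ) * ∑ Y ∈ range N, |bondF N L t Y| ≤ 3 := by
  obtain ⟨⟨hX0, hXN⟩, ⟨hj0, hjL⟩, e⟩ := fine_decomp (N := N) hL ht0 (by omega)
  rw [← e]
  rw [← e] at ht
  exact bondF_row_abs hL hX0 hXN hj0 hjL ht

end OneDim

/-! ### §2 The tensor-product lift on a box: definition and EXACT BLOCK MEANS -/

section Lift

variable (N : Fin (d + 1) → ℕ) (L : ℕ)

/-- the `(d+1)`-dimensional interpolation kernel: the tensor product `Π_μ k̃_μ(x_μ, Y_μ)` of the folded one-dimensional kernels.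
[folklore] -/
def liftK (x Y : Fin (d + 1) → ℤ) : ℝ := ∏ μ, kerF (N μ) L (x μ) (Y μ)

/-- **THE HOMOGENISED LIFT** of a coarse function `V` on the box `Π_μ [0, N_μ)` to the fine box `Π_μ [0, N_μ L)`:
`Φ(x) = Σ_Y V(Y)·Π_μ k̃_μ(x_μ, Y_μ)`. [folklore] -/
def lift (V : (Fin (d + 1) → ℤ) → ℝ) (x : Fin (d + 1) → ℤ) : ℝ := ∑ Y ∈ boxDom N, V Y * liftK N L x Y

/-- the transverse-times-bond kernel in direction `ν`: `c_ν(x, Y) = Π_{μ≠ν} k̃_μ(x_μ,Y_μ) · b_ν(x_ν, Y_ν)`. [folklore] -/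
def bondK (ν : Fin (d + 1)) (x Y : Fin (d + 1) → ℤ) : ℝ :=
  ∏ μ, (if μ = ν then bondF (N μ) L (x μ) (Y μ) else kerF (N μ) L (x μ) (Y μ))

variable {N L}

/-- **EXACT BLOCK MEANS OF THE LIFT**: `Σ_j Φ(LX + j) = L^{d+1}·V(X)` for every coarse site `X` of the box (`L ≥ 1`). [folklore] -/
theorem sum_lift_block (hL : 1 ≤ L) (V : (Fin (d + 1) → ℤ) → ℝ) {X : Fin (d + 1) → ℤ} (hX : X ∈ boxDom N) :
    ∑ j : Fin (d + 1) → Fin L, lift N L V (finePt L X j) = (L : ℝ) ^ (d + 1) * V X := by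
  classical
  unfold lift liftK
  rw [Finset.sum_comm]
  have hker : ∀ Y ∈ boxDom N, ∑ j : Fin (d + 1) → Fin L, ∏ μ, kerF (N μ) L (finePt L X j μ) (Y μ) =
      if X = Y then (L : ℝ) ^ (d + 1) else 0 := by
    intro Y hY
    have h1 : ∑ j : Fin (d + 1) → Fin L, ∏ μ, kerF (N μ) L (finePt L X j μ) (Y μ) =
        ∏ μ, ∑ jμ : Fin L, kerF (N μ) L ((L : ℤ) * X μ + ((jμ : ℕ) : ℤ)) (Y μ) := by
      simp only [finePt_apply]
      rw [← Fintype.piFinset_univ, ← Finset.prod_univ_sum (fun _ => (Finset.univ : Finset (Fin L)))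
        (fun μ jμ => kerF (N μ) L ((L : ℤ) * X μ + ((jμ : ℕ) : ℤ)) (Y μ))]
    rw [h1]
    have h2 : ∀ μ, ∑ jμ : Fin L, kerF (N μ) L ((L : ℤ) * X μ + ((jμ : ℕ) : ℤ)) (Y μ) =
        if X μ = Y μ then (L : ℝ) else 0 := by
      intro μ
      rw [Fin.sum_univ_eq_sum_range (fun j => kerF (N μ) L ((L : ℤ) * X μ + (j : ℤ)) (Y μ)) L]
      exact sum_kerF_block hL ((mem_boxDom.1 hX) μ).1 ((mem_boxDom.1 hX) μ).2 ((mem_boxDom.1 hY) μ).1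
        ((mem_boxDom.1 hY) μ).2
    simp_rw [h2]
    by_cases hXY : X = Y
    · subst hXY
      simp
    · rw [if_neg hXY]
      obtain ⟨μ, hμ⟩ : ∃ μ, X μ ≠ Y μ := Function.ne_iff.1 hXY
      exact Finset.prod_eq_zero (Finset.mem_univ μ) (if_neg hμ)
  rw [Finset.sum_congr rfl fun Y hY => by rw [← Finset.mul_sum, hker Y hY]]
  simp_rw [mul_ite, mul_zero]
  rw [Finset.sum_ite_eq (boxDom N) X (fun Y => V Y * (L : ℝ) ^ (d + 1)), if_pos hX]
  ring

end Lift

/-! ### §3 The fine increment of the lift in direction `ν`: Abel summation -/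

section Increment

variable {N : Fin (d + 1) → ℕ} {L : ℕ}

/-- splitting a product over the directions at `ν`. [folklore] -/
theorem prod_eq_mul_prod_erase (ν : Fin (d + 1)) (f : Fin (d + 1) → ℝ) :
    ∏ μ, f μ = f ν * ∏ μ ∈ Finset.univ.erase ν, f μ :=
  (Finset.mul_prod_erase Finset.univ f (Finset.mem_univ ν)).symm

/-- the bond kernel in product form: `c_ν(x,Y) = b_ν(x_ν,Y_ν)·Π_{μ≠ν} k̃_μ(x_μ,Y_μ)`. [folklore] -/
theorem bondK_eq (ν : Fin (d + 1)) (x Y : Fin (d + 1) → ℤ) :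
    bondK N L ν x Y = bondF (N ν) L (x ν) (Y ν) * ∏ μ ∈ Finset.univ.erase ν, kerF (N μ) L (x μ) (Y μ) := by
  unfold bondK
  rw [prod_eq_mul_prod_erase ν, if_pos rfl]
  congr 1
  exact Finset.prod_congr rfl fun μ hμ => by rw [if_neg (Finset.ne_of_mem_erase hμ)]

/-- **THE KERNEL INCREMENT IS AN ABEL DIFFERENCE OF BOND KERNELS**:
`K(x + e_ν, Y) − K(x, Y) = c_ν(x, Y) − c_ν(x, Y − e_ν)` for a fine bond `0 ≤ x_ν`, `x_ν + 1 < N_ν L`. [folklore] -/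
theorem liftK_succ_sub (ν : Fin (d + 1)) {x : Fin (d + 1) → ℤ} (hx0 : 0 ≤ x ν) (hx1 : x ν + 1 < N ν * L)
    (Y : Fin (d + 1) → ℤ) :
    liftK N L (x + uvec ν) Y - liftK N L x Y = bondK N L ν x Y - bondK N L ν x (Y - uvec ν) := by
  unfold liftK
  rw [prod_eq_mul_prod_erase ν, prod_eq_mul_prod_erase ν (fun μ => kerF (N μ) L (x μ) (Y μ)), bondK_eq, bondK_eq]
  have htr : ∏ μ ∈ Finset.univ.erase ν, kerF (N μ) L ((x + uvec ν) μ) (Y μ) =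
      ∏ μ ∈ Finset.univ.erase ν, kerF (N μ) L (x μ) (Y μ) :=
    Finset.prod_congr rfl fun μ hμ => by rw [Pi.add_apply, uvec_apply_ne (Finset.ne_of_mem_erase hμ), add_zero]
  have htr' : ∏ μ ∈ Finset.univ.erase ν, kerF (N μ) L (x μ) ((Y - uvec ν) μ) =
      ∏ μ ∈ Finset.univ.erase ν, kerF (N μ) L (x μ) (Y μ) :=
    Finset.prod_congr rfl fun μ hμ => by rw [Pi.sub_apply, uvec_apply_ne (Finset.ne_of_mem_erase hμ), sub_zero]
  rw [htr, htr', Pi.add_apply, uvec_apply_same, Pi.sub_apply, uvec_apply_same, ← sub_mul, ← sub_mul,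
    kerF_succ_sub _ _ hx0 hx1]

/-- membership of the upper neighbour in the box. [folklore] -/
theorem add_uvec_mem_boxDom {K : Fin (d + 1) → ℕ} (ν : Fin (d + 1)) {Y : Fin (d + 1) → ℤ} (hY : Y ∈ boxDom K) :
    Y + uvec ν ∈ boxDom K ↔ Y ν + 1 < K ν := by
  rw [mem_boxDom] at hY ⊢
  constructor
  · intro h
    have := (h ν).2
    rwa [Pi.add_apply, uvec_apply_same] at this
  · intro h μ
    by_cases hμ : μ = ν
    · subst hμ
      rw [Pi.add_apply, uvec_apply_same]
      exact ⟨by linarith [(hY μ).1], h⟩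
    · rw [Pi.add_apply, uvec_apply_ne hμ, add_zero]
      exact hY μ

/-- **THE FINE INCREMENT OF THE LIFT, ABEL-SUMMED**: for a fine bond `(x, x + e_ν)` of the box,
`Φ(x + e_ν) − Φ(x) = Σ_{Y, Y + e_ν ∈ box} (V(Y) − V(Y + e_ν))·c_ν(x, Y)` — the coarse GRADIENT appears, weighted by the bond
kernel. [folklore] -/
theorem lift_succ_sub (ν : Fin (d + 1)) (V : (Fin (d + 1) → ℤ) → ℝ) {x : Fin (d + 1) → ℤ} (hx0 : 0 ≤ x ν)
    (hx1 : x ν + 1 < N ν * L) :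
    lift N L V (x + uvec ν) - lift N L V x =
      ∑ Y ∈ (boxDom N).filter (fun Y => Y + uvec ν ∈ boxDom N), (V Y - V (Y + uvec ν)) * bondK N L ν x Y := by
  classical
  unfold lift
  rw [← Finset.sum_sub_distrib]
  simp_rw [← mul_sub, liftK_succ_sub ν hx0 hx1, mul_sub]
  rw [Finset.sum_sub_distrib]
  -- first sum: the top layer `Y_ν = N_ν − 1` drops (`b(·, N_ν − 1) = 0`)
  have h1 : ∑ Y ∈ boxDom N, V Y * bondK N L ν x Y =
      ∑ Y ∈ (boxDom N).filter (fun Y => Y + uvec ν ∈ boxDom N), V Y * bondK N L ν x Y := by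
    rw [Finset.sum_filter]
    refine Finset.sum_congr rfl fun Y hY => ?_
    split_ifs with h
    · rfl
    · rw [add_uvec_mem_boxDom ν hY, not_lt] at h
      have hYν : Y ν = (N ν : ℤ) - 1 := by have := ((mem_boxDom.1 hY) ν).2; omega
      rw [bondK_eq, hYν, bondF_last, zero_mul, mul_zero]
  -- second sum: the bottom layer `Y_ν = 0` drops (`b(·, −1) = 0`), the rest is re-indexed by `Y = Y″ + e_ν`
  have h2 : ∑ Y ∈ boxDom N, V Y * bondK N L ν x (Y - uvec ν) =
      ∑ Y ∈ (boxDom N).filter (fun Y => Y + uvec ν ∈ boxDom N), V (Y + uvec ν) * bondK N L ν x Y := by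
    have hsplit := (Finset.sum_filter_add_sum_filter_not (boxDom N) (fun Y => 1 ≤ Y ν)
      (fun Y => V Y * bondK N L ν x (Y - uvec ν))).symm
    rw [hsplit]
    have hzero : ∑ Y ∈ (boxDom N).filter (fun Y => ¬ 1 ≤ Y ν), V Y * bondK N L ν x (Y - uvec ν) = 0 := by
      refine Finset.sum_eq_zero fun Y hY => ?_
      rw [Finset.mem_filter] at hY
      have hYν : (Y - uvec ν) ν = -1 := by
        rw [Pi.sub_apply, uvec_apply_same]
        have := ((mem_boxDom.1 hY.1) ν).1
        omega
      rw [bondK_eq, hYν, bondF_neg_one, zero_mul, mul_zero]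
    rw [hzero, add_zero]
    refine Finset.sum_nbij' (fun Y => Y - uvec ν) (fun Y => Y + uvec ν) ?_ ?_ ?_ ?_ ?_
    · intro Y hY
      rw [Finset.mem_filter] at hY ⊢
      have hmem : Y - uvec ν ∈ boxDom N := by
        rw [mem_boxDom] at hY ⊢
        intro μ
        by_cases hμ : μ = ν
        · subst hμ; rw [Pi.sub_apply, uvec_apply_same]; constructor <;> linarith [(hY.1 μ).1, (hY.1 μ).2, hY.2]
        · rw [Pi.sub_apply, uvec_apply_ne hμ, sub_zero]; exact hY.1 μ
      exact ⟨hmem, by rw [sub_add_cancel]; exact hY.1⟩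
    · intro Y hY
      rw [Finset.mem_filter] at hY ⊢
      refine ⟨hY.2, ?_⟩
      rw [Pi.add_apply, uvec_apply_same]
      linarith [((mem_boxDom.1 hY.1) ν).1]
    · intro Y _; simp
    · intro Y _; simp
    · intro Y _; rw [sub_add_cancel]
  rw [h1, h2, ← Finset.sum_sub_distrib]
  refine Finset.sum_congr rfl fun Y _ => by ring

end Increment

end Summit.QuantumFields.BalabanUV.T4Continuum.NE7K1LinHomLift
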